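/-
Copyright (c) 2026 the pub-hodgecm-mathlib formalisation cell (harness21).  Prover seat hodgecm-mathlib-K2Liu-p01 (g0): Track B «K2-LIT», #184♮ = hLiu418,
helper H4b for socket #13 `sig_K2LiuDoublingUnfold` (U5 «DOUBLING ZETA», LEAD F0P6-plan (g10) DEAL 2026-09-03T21:14:18Z).
-/
import Literature.NumberTheory.K2Lit.DoublingEmbedding
import Literature.NumberTheory.GelbartRogawski1991.CompatibleSplittingCMDoubling
import Summits.HodgeConjecture.HodgeConjecture.Theorems.K2LiuDoublingUnfoldMainOrbitBlocks
import Summits.HodgeConjecture.HodgeConjecture.Theorems.K2LiuDoublingUnfoldOrbit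
import HarnessLib

/-!
# Crux `HLiu418`, Track B road `K2_Liu`, unit U5, helper H4b for socket #13: the SINGLE-ORBIT LEMMA `mainOrbit` for the doubled CM datum
# (Liu 2021 (B.5) at `a = 0`: `H(L⁺) = P_Δ(L⁺) · ι(U(V)(L⁺) × 1)` for anisotropic `V`)

Cell `hodgecm-mathlib`, crux item hLiu418 = `stmt-HodgeConjecture-24832`; prover K2Liu-p01 (g0) (REPORT-FIRST plan for #13, item H4).  THEOREMS ONLY
(no `def`, no instance, no notation, no `sorry`); imports ★ K2Lit `DoublingEmbedding` (`iotaLeft`), ★ `CompatibleSplittingCMDoubling`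
(`hermD_eq`, `inlGRat`, `inlG_rationalPairToAdelic`), ★ H4a `K2LiuDoublingUnfoldMainOrbitBlocks` (p855107: the block lemma), ★ H7
`K2LiuDoublingUnfoldOrbit` (p855008: `iotaGG_inl_one`) + HarnessLib; lane `--supports stmt-HodgeConjecture-24832 --as helper`.

WHAT IS PROVED.  `mainOrbit` — the hypothesis `hMain` of ★ `K2LiuDoublingUnfoldOfMainOrbit.doublingUnfold_of_mainOrbit` (p855075): for the
doubled CM datum with `W` a line (`M = 1`), `dV i ≠ 0`, `dW 0 ≠ 0` and `diag dV` anisotropic, **every `h ∈ H(L⁺)` satisfies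
`h · ι(a₀, 1)⁻¹ ∈ P_Δ(𝔸)` for some rational `a₀ ∈ U(diag dV)(L⁺)`**.  DICTIONARY (this file) + MATHEMATICS (★ H4a): `h = (h₀)_𝔸` with
`h₀ ∈ U(J^𝔻)(L)`, `J^𝔻 = reindex e₂ (J ⊕ −J)`, `J = reindex e (diag dV ⊗ diag dW) = reindex ε (dW₀ · diag dV)` (★ `hermD_eq`;
`ε : Fin N ≃ Fin n` since `Fin 1` is a point); the block matrix `B = reindex e₂⁻¹ h₀` is an isometry of `J ⊕ −J` and `J` is anisotropic, so ★
`exists_mainOrbit_block` gives an invertible `J`-unitary `A` with `B₁₁ − B₂₁ = (B₂₂ − B₁₂)A`; `a₀ := reindex ε⁻¹ A` is `diag dV`-unitary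
(the scalar `dW₀ ≠ 0` cancels), `ι(a₀, 1) = (inlGRat(a₀ ⊗ 1))_𝔸` has block matrix `diag(A, 1)`, and ★ `siegel_of_mainOrbit_block` is the Siegel
condition for `B · diag(A⁻¹, 1)`, i.e. for `h · ι(a₀, 1)⁻¹`.
HONEST LABEL.  Count-neutral helper; `HC_CM` is proved only modulo the 7 printed citations (hLiu418 = 24832, h413 = 24833) until rung 0 closes.

## References
* [Liu2021] Y. Liu, *Fourier–Jacobi cycles and arithmetic relative trace formula*, Camb. J. Math. 9 (2021): App. B §B.3 (B.5) p. 101, Lem. B.11 p. 102.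
* [GelbartPiatetskishapiroRallis1987] S. Gelbart, I. Piatetski-Shapiro, S. Rallis, LNM 1254 (1987), Part A §1.
-/

noncomputable section

open scoped Matrix Kronecker
open NumberField IsDedekindDomain Matrix

namespace Summit.HodgeConjecture.HodgeConjecture.Cruxes.HLiu418.K2LiuDoublingUnfoldMainOrbit

open Literature.NumberTheory.Automorphic Literature.NumberTheory.GaloisRepresentations
open Literature.NumberTheory.GelbartRogawski1991 Literature.NumberTheory.GelbartRogawski1991.GRConstruction
open Literature.NumberTheory.K2Lit.SiegelDoubled
open Literature.AlgebraicGeometry.ShimuraVarieties (hermForm)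
open Summit.HodgeConjecture.HodgeConjecture.Cruxes.HLiu418.K2LiuDoublingUnfoldMainOrbitBlocks
open Summit.HodgeConjecture.HodgeConjecture.Cruxes.HLiu418.K2LiuDoublingUnfoldOrbit (iotaGG_inl_one)

/-! ## §1 Reindexing bookkeeping (generic) -/

section Reindex

variable {R : Type*} [CommRing R] (σ : R →+* R) {m m' : Type*} [Fintype m] [Fintype m'] [DecidableEq m] [DecidableEq m'] (ε : m ≃ m')

omit [DecidableEq m] [DecidableEq m'] in
/-- `reindex ε` commutes with `X ↦ ᵗ(σ X) H X`. [folklore] -/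
theorem reindex_isometryForm (X H : Matrix m m R) :
    ((reindex ε ε X).map σ)ᵀ * reindex ε ε H * reindex ε ε X = reindex ε ε ((X.map σ)ᵀ * H * X) := by
  simp only [reindex_apply, ← submatrix_map, transpose_submatrix, submatrix_mul_equiv]

omit [DecidableEq m] [DecidableEq m'] in
/-- `reindex ε` is multiplicative. [folklore] -/
theorem reindex_mul_reindex (X Y : Matrix m m R) : reindex ε ε X * reindex ε ε Y = reindex ε ε (X * Y) := by
  simp only [reindex_apply, submatrix_mul_equiv]

omit [CommRing R] [Fintype m] [Fintype m'] [DecidableEq m] [DecidableEq m'] in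
/-- `reindex ε⁻¹ ∘ reindex ε = id`. [folklore] -/
theorem reindex_symm_reindex (X : Matrix m m R) : reindex ε.symm ε.symm (reindex ε ε X) = X := by
  rw [← reindex_symm, Equiv.symm_apply_apply]

/-- `IsUnit (reindex ε ε X) ↔ IsUnit X`. [folklore] -/
theorem isUnit_reindex_iff (X : Matrix m m R) : IsUnit (reindex ε ε X) ↔ IsUnit X := by
  rw [isUnit_iff_isUnit_det, isUnit_iff_isUnit_det, det_reindex_self]

omit [DecidableEq m] [DecidableEq m'] in
/-- the sesquilinear form of `reindex ε ε H` at `v` is that of `H` at `v ∘ ε`. [folklore] -/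
theorem conj_dotProduct_reindex_mulVec (H : Matrix m m R) (v : m' → R) :
    (⇑σ ∘ v) ⬝ᵥ (reindex ε ε H *ᵥ v) = (⇑σ ∘ (v ∘ ε)) ⬝ᵥ (H *ᵥ (v ∘ ε)) := by
  rw [reindex_apply, submatrix_mulVec_equiv, Equiv.symm_symm, dotProduct_comp_equiv_symm]
  rfl

end Reindex

/-! ## §2 The frame at `M = 1`: `Fin N ≃ Fin n`, the Gram matrix `J`, anisotropy -/

section Frame

variable (L : Type) [Field L]
variable {N n : ℕ} (e : Fin N × Fin 1 ≃ Fin n) (dV : Fin N → L) (dW : Fin 1 → L)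

/-- **`J = reindex e (diag dV ⊗ diag dW) = reindex ε (dW 0 • diag dV)`**, `ε = (Fin N ≃ Fin N × Fin 1) ≫ e` (`Fin 1` is a point).
[cite: Liu2021, §B.3 p. 101] -/
theorem gram_line_eq :
    reindex e e (Matrix.diagonal dV ⊗ₖ Matrix.diagonal dW) =
      reindex ((Equiv.prodUnique (Fin N) (Fin 1)).symm.trans e) ((Equiv.prodUnique (Fin N) (Fin 1)).symm.trans e) (dW 0 • Matrix.diagonal dV) := by
  ext k l
  obtain ⟨⟨i, p⟩, rfl⟩ := e.surjective k
  obtain ⟨⟨j, q⟩, rfl⟩ := e.surjective l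
  obtain rfl : p = 0 := Fin.eq_zero p
  obtain rfl : q = 0 := Fin.eq_zero q
  simp only [reindex_apply, submatrix_apply, Equiv.symm_trans_apply, Equiv.symm_apply_apply, Equiv.symm_symm, Equiv.prodUnique_apply,
    Matrix.kroneckerMap_apply, Matrix.smul_apply, smul_eq_mul, diagonal_apply_eq]
  exact mul_comm _ _

/-- **`a ⊗ 1` at `M = 1` is `reindex ε a`**: `reindex e (a ⊗ₖ 1) = reindex ε a`. [cite: Liu2021, §B.3 p. 101] -/
theorem kronecker_one_line_eq (a : Matrix (Fin N) (Fin N) L) :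
    reindex e e (a ⊗ₖ (1 : Matrix (Fin 1) (Fin 1) L)) =
      reindex ((Equiv.prodUnique (Fin N) (Fin 1)).symm.trans e) ((Equiv.prodUnique (Fin N) (Fin 1)).symm.trans e) a := by
  ext k l
  obtain ⟨⟨i, p⟩, rfl⟩ := e.surjective k
  obtain ⟨⟨j, q⟩, rfl⟩ := e.surjective l
  obtain rfl : p = 0 := Fin.eq_zero p
  obtain rfl : q = 0 := Fin.eq_zero q
  simp only [reindex_apply, submatrix_apply, Equiv.symm_trans_apply, Equiv.symm_apply_apply, Equiv.symm_symm, Equiv.prodUnique_apply,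
    Matrix.kroneckerMap_apply, one_apply_eq, mul_one]

/-- **Anisotropy of `J = reindex e (diag dV ⊗ diag dW)`** (for the `σ`-sesquilinear form) from anisotropy of `diag dV` and `dW 0 ≠ 0`.
[cite: Liu2021, §B.3 p. 101] -/
theorem anisotropic_gram_line (σ : L →+* L) (hdW0 : dW 0 ≠ 0)
    (hanis : ∀ x : Fin N → L, (⇑σ ∘ x) ⬝ᵥ (Matrix.diagonal dV *ᵥ x) = 0 → x = 0)
    (v : Fin n → L) (hv : (⇑σ ∘ v) ⬝ᵥ (reindex e e (Matrix.diagonal dV ⊗ₖ Matrix.diagonal dW) *ᵥ v) = 0) : v = 0 := by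
  rw [gram_line_eq, conj_dotProduct_reindex_mulVec, smul_mulVec, dotProduct_smul, smul_eq_zero] at hv
  rcases hv with h | h
  · exact absurd h hdW0
  · have hv' := hanis _ h
    funext k
    have := congrFun hv' (((Equiv.prodUnique (Fin N) (Fin 1)).symm.trans e).symm k)
    rw [Function.comp_apply, Equiv.apply_symm_apply] at this
    exact this

end Frame

/-! ## §3 The dictionary and `mainOrbit` -/

section Main

variable (L : Type) [Field L] [NumberField L] [IsCMField L]
variable {N n : ℕ} (e : Fin N × Fin 1 ≃ Fin n)
  (dV : Fin N → L) (hdV : ∀ i, IsCMField.complexConj L (dV i) = dV i)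
  (dW : Fin 1 → L) (hdW : ∀ i, IsCMField.complexConj L (dW i) = dW i)

/-- **`ι(a₀, 1) = (inlGRat (a₀ ⊗ 1))_𝔸`** for rational `a₀` (★ `adelicInl_toAdelic`, ★ `iotaGG_inl_one`, ★ `inlG_rationalPairToAdelic`).
[cite: Liu2021, §B.3 p. 101] -/
theorem iotaLeft_toAdelic_eq (a₀ : UnitaryGroup.rational (Fp L) L (IsCMField.complexConj L) N (Matrix.diagonal dV)) :
    iotaLeft L e dV hdV dW hdW (UnitaryGroup.toAdelic (Fp L) L (IsCMField.complexConj L) N (Matrix.diagonal dV) a₀) =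
      UnitaryGroup.toAdelic (Fp L) L (IsCMField.complexConj L) (n + n) (hermD L e dV hdV dW hdW)
        (inlGRat L e dV hdV dW hdW (UnitaryGroup.rationalInl (Fp L) L (IsCMField.complexConj L) N 1 (Matrix.diagonal dV) (Matrix.diagonal dW) a₀)) := by
  rw [iotaLeft_apply, iotaV, MonoidHom.comp_apply, MonoidHom.prodMap_def, MonoidHom.prod_apply, MonoidHom.comp_apply, MonoidHom.comp_apply,
    MonoidHom.coe_fst, MonoidHom.coe_snd, map_one, UnitaryGroup.adelicInl_toAdelic, iotaGG_inl_one, inlG_rationalPairToAdelic]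

/-- the block matrix of the rational element `inlGRat (a₀ ⊗ 1)` is `diag(reindex e (a₀ ⊗ 1), 1)`. [cite: Liu2021, §B.3 p. 101] -/
theorem blk_inlGRat_rationalInl (a₀ : UnitaryGroup.rational (Fp L) L (IsCMField.complexConj L) N (Matrix.diagonal dV)) :
    reindex (e₂ (n := n)).symm (e₂ (n := n)).symm
        (((inlGRat L e dV hdV dW hdW (UnitaryGroup.rationalInl (Fp L) L (IsCMField.complexConj L) N 1 (Matrix.diagonal dV) (Matrix.diagonal dW) a₀)) :
            GL (Fin (n + n)) L) : Matrix (Fin (n + n)) (Fin (n + n)) L) =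
      Matrix.fromBlocks (reindex e e (((a₀ : GL (Fin N) L) : Matrix (Fin N) (Fin N) L) ⊗ₖ (1 : Matrix (Fin 1) (Fin 1) L))) 0 0 1 := by
  change reindex (e₂ (n := n)).symm (e₂ (n := n)).symm (reindex (e₂ (n := n)) (e₂ (n := n))
    (Matrix.fromBlocks (reindex e e (((a₀ : GL (Fin N) L) : Matrix (Fin N) (Fin N) L) ⊗ₖ (1 : Matrix (Fin 1) (Fin 1) L))) 0 0 1)) = _
  rw [← reindex_symm, Equiv.symm_apply_apply]

/-- **A rational element of `H` is in `P_Δ(𝔸)` as soon as its BLOCK MATRIX satisfies the Siegel condition** (`blk ((x)_𝔸) = (reindex e₂⁻¹ x) ⊗ 1`).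
[cite: Liu2021, §B.3 p. 101] -/
theorem isSiegelDelta_toAdelic_of_blocks (x : UnitaryGroup.rational (Fp L) L (IsCMField.complexConj L) (n + n) (hermD L e dV hdV dW hdW))
    (hx : (reindex (e₂ (n := n)).symm (e₂ (n := n)).symm ((x : GL (Fin (n + n)) L) : Matrix (Fin (n + n)) (Fin (n + n)) L)).toBlocks₁₁ +
        (reindex (e₂ (n := n)).symm (e₂ (n := n)).symm ((x : GL (Fin (n + n)) L) : Matrix (Fin (n + n)) (Fin (n + n)) L)).toBlocks₁₂ =
      (reindex (e₂ (n := n)).symm (e₂ (n := n)).symm ((x : GL (Fin (n + n)) L) : Matrix (Fin (n + n)) (Fin (n + n)) L)).toBlocks₂₁ +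
        (reindex (e₂ (n := n)).symm (e₂ (n := n)).symm ((x : GL (Fin (n + n)) L) : Matrix (Fin (n + n)) (Fin (n + n)) L)).toBlocks₂₂) :
    IsSiegelDelta L e dV hdV dW hdW (UnitaryGroup.toAdelic (Fp L) L (IsCMField.complexConj L) (n + n) (hermD L e dV hdV dW hdW) x) := by
  have hm : (((UnitaryGroup.toAdelic (Fp L) L (IsCMField.complexConj L) (n + n) (hermD L e dV hdV dW hdW) x : HA L e dV hdV dW hdW) :
      GL (Fin (n + n)) (AdeleRing (𝓞 L) L)) : Matrix (Fin (n + n)) (Fin (n + n)) (AdeleRing (𝓞 L) L)) =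
      ((x : GL (Fin (n + n)) L) : Matrix (Fin (n + n)) (Fin (n + n)) L).map (algebraMap L (AdeleRing (𝓞 L) L)) := rfl
  unfold IsSiegelDelta blk
  rw [hm, reindex_apply, submatrix_map, ← reindex_apply]
  have h := congrArg (fun X : Matrix (Fin n) (Fin n) L => X.map (algebraMap L (AdeleRing (𝓞 L) L))) hx
  rw [Matrix.map_add _ (map_add _), Matrix.map_add _ (map_add _)] at h
  exact h

/-- **THE SINGLE-ORBIT LEMMA `mainOrbit`** (hypothesis `hMain` of ★ `doublingUnfold_of_mainOrbit`): for `dW 0 ≠ 0` and `diag dV` anisotropic,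
every `h ∈ H(L⁺)` satisfies `h · ι(a₀, 1)⁻¹ ∈ P_Δ(𝔸)` for some rational `a₀ ∈ U(diag dV)(L⁺)` (★ H4a `exists_mainOrbit_block` +
`siegel_of_mainOrbit_block` through the dictionary of §1–§3). [cite: Liu2021, §B.3 (B.5) p. 101] [cite: Liu2021, Lem. B.11 p. 102]
[cite: GelbartPiatetskishapiroRallis1987, Part A §1] -/
theorem mainOrbit (hdW0 : dW 0 ≠ 0) (hanis : ∀ x : Fin N → L, hermForm (cmConjRingHom L) (Matrix.diagonal dV) x x = 0 → x = 0)
    (h : ratH L e dV hdV dW hdW) :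
    ∃ a₀ : UnitaryGroup.rational (Fp L) L (IsCMField.complexConj L) N (Matrix.diagonal dV),
      IsSiegelDelta L e dV hdV dW hdW ((h : HA L e dV hdV dW hdW) *
        (iotaLeft L e dV hdV dW hdW (UnitaryGroup.toAdelic (Fp L) L (IsCMField.complexConj L) N (Matrix.diagonal dV) a₀))⁻¹) := by
  obtain ⟨h₀, hh₀⟩ := MonoidHom.mem_range.1 h.2
  -- `h₀` is an isometry of `hermD = reindex e₂ (J ⊕ −J)`; its block matrix `Bm := reindex e₂⁻¹ h₀` is an isometry of `J ⊕ −J`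
  have hu := mem_unitaryGroupOfForm_iff.1 h₀.2
  generalize hX : ((h₀ : GL (Fin (n + n)) L) : Matrix (Fin (n + n)) (Fin (n + n)) L) = X at hu
  rw [hermD_eq] at hu
  have hB := congrArg (reindex (e₂ (n := n)).symm (e₂ (n := n)).symm) hu
  rw [← reindex_isometryForm, reindex_symm_reindex] at hB
  set ε : Fin N ≃ Fin n := (Equiv.prodUnique (Fin N) (Fin 1)).symm.trans e with hε
  set J : Matrix (Fin n) (Fin n) L := reindex e e (Matrix.diagonal dV ⊗ₖ Matrix.diagonal dW) with hJ_def
  set Bm : Matrix (Fin n ⊕ Fin n) (Fin n ⊕ Fin n) L := reindex (e₂ (n := n)).symm (e₂ (n := n)).symm X with hBm_def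
  -- anisotropy of `J`
  have hanisJ : ∀ v : Fin n → L, (⇑((IsCMField.complexConj L : L ≃ₐ[Fp L] L) : L →+* L) ∘ v) ⬝ᵥ (J *ᵥ v) = 0 → v = 0 :=
    fun v hv => anisotropic_gram_line L e dV dW _ hdW0 (fun x hx => hanis x hx) v hv
  -- ★ H4a: the block lemma
  obtain ⟨A, hAu, hAJ, hBA⟩ := exists_mainOrbit_block _ J hanisJ Bm hB
  -- `a₀ := reindex ε⁻¹ A` is invertible and `diag dV`-unitary (the scalar `dW 0 ≠ 0` cancels)
  set a₀m : Matrix (Fin N) (Fin N) L := reindex ε.symm ε.symm A with ha₀m_def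
  have hA : reindex ε ε a₀m = A := by rw [ha₀m_def, ← reindex_symm, Equiv.apply_symm_apply]
  have ha₀u : IsUnit a₀m := by rw [← isUnit_reindex_iff ε, hA]; exact hAu
  have hmem : (ha₀u.unit : GL (Fin N) L) ∈ UnitaryGroup.rational (Fp L) L (IsCMField.complexConj L) N (Matrix.diagonal dV) := by
    rw [UnitaryGroup.rational, mem_unitaryGroupOfForm_iff, IsUnit.unit_spec]
    have h1 := hAJ
    rw [hJ_def, gram_line_eq, ← hε, ← hA, reindex_isometryForm] at h1
    have h2 := (reindex ε ε).injective h1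
    rw [Matrix.mul_smul, Matrix.smul_mul] at h2
    have h3 := congrArg (fun M : Matrix (Fin N) (Fin N) L => (dW 0)⁻¹ • M) h2
    rwa [smul_smul, smul_smul, inv_mul_cancel₀ hdW0, one_smul, one_smul] at h3
  refine ⟨⟨ha₀u.unit, hmem⟩, ?_⟩
  -- rewrite `h · ι(a₀,1)⁻¹` as the adelic image of ONE rational element and read its block matrix
  rw [← hh₀, iotaLeft_toAdelic_eq, ← map_inv, ← map_mul]
  refine isSiegelDelta_toAdelic_of_blocks L e dV hdV dW hdW _ ?_
  -- block matrix of `ι(a₀, 1)` is `diag(A, 1)`, whose inverse is `diag(A⁻¹, 1)`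
  have hι : reindex (e₂ (n := n)).symm (e₂ (n := n)).symm
      (((inlGRat L e dV hdV dW hdW (UnitaryGroup.rationalInl (Fp L) L (IsCMField.complexConj L) N 1 (Matrix.diagonal dV) (Matrix.diagonal dW)
          ⟨ha₀u.unit, hmem⟩)) : GL (Fin (n + n)) L) : Matrix (Fin (n + n)) (Fin (n + n)) L) = Matrix.fromBlocks A 0 0 1 := by
    rw [blk_inlGRat_rationalInl, kronecker_one_line_eq]
    change Matrix.fromBlocks (reindex ε ε a₀m) 0 0 1 = _
    rw [hA]
  have hιinv : (Matrix.fromBlocks A 0 0 (1 : Matrix (Fin n) (Fin n) L))⁻¹ = Matrix.fromBlocks A⁻¹ 0 0 1 := by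
    refine Matrix.inv_eq_right_inv ?_
    rw [fromBlocks_multiply, mul_nonsing_inv _ ((isUnit_iff_isUnit_det A).1 hAu)]
    simp
  -- block matrix of `h₀ · ι(a₀,1)⁻¹` is `Bm · diag(A⁻¹, 1)`: ★ H4a `siegel_of_mainOrbit_block`
  have hprod : reindex (e₂ (n := n)).symm (e₂ (n := n)).symm
      (((h₀ * (inlGRat L e dV hdV dW hdW (UnitaryGroup.rationalInl (Fp L) L (IsCMField.complexConj L) N 1 (Matrix.diagonal dV) (Matrix.diagonal dW)
          ⟨ha₀u.unit, hmem⟩))⁻¹ : UnitaryGroup.rational (Fp L) L (IsCMField.complexConj L) (n + n) (hermD L e dV hdV dW hdW)) : GL (Fin (n + n)) L) :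
            Matrix (Fin (n + n)) (Fin (n + n)) L) = Bm * Matrix.fromBlocks A⁻¹ 0 0 1 := by
    rw [Subgroup.coe_mul, Subgroup.coe_inv, Units.val_mul, Matrix.coe_units_inv, ← reindex_mul_reindex, hX, ← hBm_def, ← inv_reindex, hι, hιinv]
  rw [hprod]
  exact siegel_of_mainOrbit_block Bm hAu hBA

end Main

end Summit.HodgeConjecture.HodgeConjecture.Cruxes.HLiu418.K2LiuDoublingUnfoldMainOrbit
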